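import Mathlib.Analysis.Normed.Group.AddCircle
import Mathlib.Analysis.Complex.Basic
import Literature.NumberTheory.LFunctions.PlateauMollifier

/-!
# Route `GreenTaoLevelTwo`, crux `GITwo` (stmt-Parity-21275), line `birth`, stub `stub_cyclicInverse`:
# Lipschitz cutoffs on the circle and the "seam" lemma (GT08a arXiv §12, proof of Thm. 68 / Lemma 69)

Sixty-third helper file toward the XL stub `stub_cyclicInverse` (B. Green, T. Tao, *An inverse
theorem for the Gowers `U³(G)` norm*, arXiv:math/0503014, Thm. 68 = PEMS 51 (2008) Thm. 12.8).
Block E16 (arXiv §12).  Proof of Thm. 68: "let `χ: ℝ/ℤ → [0,1]` be a continuous function such that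
`χ(x)=1` when `|x| < ρ(1 − ε)` and `χ(x) = 0` when `1/2 ≥ |x| > ρ(1 + ε)`"; proof of Lemma 69: the
functions `χ(x) e(sx)` (`|s| ≤ ½`, `x ∈ (−½,½]`) are Lipschitz on `ℝ/ℤ` because `χ` kills the seam
`x = ±½` where the fractional part jumps.  Def-free (the cutoff is produced existentially):

(The `1`-Lipschitz clamp is reused from `Literature…PlateauMollifier.abs_clamp_sub_clamp_le`.)

* `exists_circle_cutoff` — for `r₁ < r₂` a cutoff `κ : ℝ/ℤ → [0,1]`, `(r₂−r₁)⁻¹`-Lipschitz, `= 1` on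
  `‖a‖ ≤ r₁`, `= 0` on `‖a‖ ≥ r₂` (piecewise linear in `‖a‖`);
* `norm_sub_le_of_vanishing_near_seam` — a `1`-bounded `Ψ : ℝ/ℤ → ℂ` vanishing on `‖a‖ ≥ r₂`
  (`r₂ < ½`) and `L`-Lipschitz along representatives in `[−½,½]` at distance `≤ ½` is
  `(L + 2/(½ − r₂))`-Lipschitz on `ℝ/ℤ`.

References: [GreenTao2008U3Inverse] arXiv:math/0503014, §12, proof of Thm. 68 and of Lemma 69.
-/

noncomputable section

namespace Summit.Parity.GeneralizedHardyLittlewood.GreenTaoLevelTwoGITwoCyclicInverse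

/-- **A Lipschitz cutoff on `ℝ/ℤ`** (proof of arXiv Thm. 68, the function `χ`): for `r₁ < r₂` there is
`κ : ℝ/ℤ → [0,1]`, `(r₂ − r₁)⁻¹`-Lipschitz for the quotient metric, with `κ = 1` on `‖a‖ ≤ r₁` and
`κ = 0` on `‖a‖ ≥ r₂`. [cite: GreenTao2008U3Inverse, §12, proof of Thm. 68] -/
theorem exists_circle_cutoff {r₁ r₂ : ℝ} (hr : r₁ < r₂) :
    ∃ κ : AddCircle (1 : ℝ) → ℝ, (∀ a, 0 ≤ κ a ∧ κ a ≤ 1) ∧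
      (∀ a b, |κ a - κ b| ≤ (1 / (r₂ - r₁)) * dist a b) ∧
      (∀ a, ‖a‖ ≤ r₁ → κ a = 1) ∧ (∀ a, r₂ ≤ ‖a‖ → κ a = 0) := by
  have hd : 0 < r₂ - r₁ := sub_pos.2 hr
  refine ⟨fun a => max 0 (min 1 ((r₂ - ‖a‖) / (r₂ - r₁))), fun a => ⟨le_max_left _ _,
    max_le zero_le_one (min_le_left _ _)⟩, fun a b => ?_, fun a ha => ?_, fun a ha => ?_⟩
  · refine (Literature.NumberTheory.LFunctions.PlateauMollifier.abs_clamp_sub_clamp_le _ _).trans ?_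
    rw [← sub_div, abs_div, abs_of_pos hd, show r₂ - ‖a‖ - (r₂ - ‖b‖) = ‖b‖ - ‖a‖ by ring,
      div_eq_inv_mul, one_div]
    refine mul_le_mul_of_nonneg_left ?_ (inv_nonneg.2 hd.le)
    rw [dist_eq_norm]
    have := abs_norm_sub_norm_le b a
    rwa [← norm_neg (b - a), neg_sub] at this
  · have h1 : 1 ≤ (r₂ - ‖a‖) / (r₂ - r₁) := by
      rw [le_div_iff₀ hd]; linarith
    simp only
    rw [min_eq_left h1, max_eq_right zero_le_one]
  · have h1 : (r₂ - ‖a‖) / (r₂ - r₁) ≤ 0 := div_nonpos_of_nonpos_of_nonneg (by linarith) hd.le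
    simp only
    rw [min_eq_right (h1.trans zero_le_one), max_eq_left h1]

/-- A point of `ℝ/ℤ` has a representative `x` with `|x| = ‖a‖ ≤ ½`. [folklore] -/
theorem exists_rep_abs_eq_norm (a : AddCircle (1 : ℝ)) :
    ∃ x : ℝ, (x : AddCircle (1 : ℝ)) = a ∧ |x| = ‖a‖ ∧ |x| ≤ 1 / 2 := by
  obtain ⟨x, rfl⟩ := QuotientAddGroup.mk_surjective a
  refine ⟨x - round x, ?_, ?_, abs_sub_round x⟩
  · rw [AddCircle.coe_sub]
    have : ((round x : ℝ) : AddCircle (1 : ℝ)) = 0 := by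
      rw [AddCircle.coe_eq_zero_iff]; exact ⟨round x, by simp⟩
    rw [this, sub_zero]
  · exact UnitAddCircle.norm_eq.symm

/-- `‖(t : ℝ/ℤ)‖ = |t|` for `|t| ≤ ½`. [folklore] -/
theorem norm_coe_eq_abs_of_le {t : ℝ} (ht : |t| ≤ 1 / 2) : ‖(t : AddCircle (1 : ℝ))‖ = |t| := by
  refine (AddCircle.norm_coe_eq_abs_iff (1 : ℝ) one_ne_zero).2 ?_
  rw [abs_one]; exact ht

/-- **The seam lemma on `ℝ/ℤ`** (proof of arXiv Lemma 69: "`F(x,y) := χ(x)e(sx)e(y)` … identify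
`x ∈ ℝ/ℤ` with a real number from `−1/2` to `1/2` … It is not hard to check that `F` is
`50`-Lipschitz").  Let `Ψ : ℝ/ℤ → ℂ` be `1`-bounded, vanish on `‖a‖ ≥ r₂` (`r₂ < ½`), and satisfy
`‖Ψ(x) − Ψ(y)‖ ≤ L|x − y|` for representatives `|x|,|y| ≤ ½` with `|x − y| ≤ ½`.  Then
`‖Ψ a − Ψ b‖ ≤ (L + 2/(½ − r₂)) · dist a b` for all `a, b`.
[cite: GreenTao2008U3Inverse, §12, proof of Lemma 69] -/
theorem norm_sub_le_of_vanishing_near_seam {Ψ : AddCircle (1 : ℝ) → ℂ} {r₂ L : ℝ}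
    (hr : r₂ < 1 / 2) (hL : 0 ≤ L) (hb : ∀ a, ‖Ψ a‖ ≤ 1) (hvan : ∀ a, r₂ ≤ ‖a‖ → Ψ a = 0)
    (hlip : ∀ x y : ℝ, |x| ≤ 1 / 2 → |y| ≤ 1 / 2 → |x - y| ≤ 1 / 2 →
      ‖Ψ (x : AddCircle (1 : ℝ)) - Ψ (y : AddCircle (1 : ℝ))‖ ≤ L * |x - y|)
    (a b : AddCircle (1 : ℝ)) :
    ‖Ψ a - Ψ b‖ ≤ (L + 2 / (1 / 2 - r₂)) * dist a b := by
  obtain ⟨x, rfl, hxa, hx⟩ := exists_rep_abs_eq_norm a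
  obtain ⟨y, rfl, hyb, hy⟩ := exists_rep_abs_eq_norm b
  have hgap : 0 < 1 / 2 - r₂ := by linarith
  have hK : 0 ≤ 2 / (1 / 2 - r₂) := div_nonneg zero_le_two hgap.le
  have hdist : dist ((x : ℝ) : AddCircle (1 : ℝ)) ((y : ℝ) : AddCircle (1 : ℝ)) =
      ‖((x - y : ℝ) : AddCircle (1 : ℝ))‖ := by
    rw [dist_eq_norm, AddCircle.coe_sub]
  have hd0 : 0 ≤ dist ((x : ℝ) : AddCircle (1 : ℝ)) ((y : ℝ) : AddCircle (1 : ℝ)) := dist_nonneg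
  by_cases hxy : |x - y| ≤ 1 / 2
  · -- close representatives: `dist = |x − y|`
    have hd : dist ((x : ℝ) : AddCircle (1 : ℝ)) ((y : ℝ) : AddCircle (1 : ℝ)) = |x - y| := by
      rw [hdist, norm_coe_eq_abs_of_le hxy]
    rw [hd]
    calc ‖Ψ (x : AddCircle (1 : ℝ)) - Ψ (y : AddCircle (1 : ℝ))‖ ≤ L * |x - y| := hlip x y hx hy hxy
      _ ≤ (L + 2 / (1 / 2 - r₂)) * |x - y| :=
          mul_le_mul_of_nonneg_right (by linarith) (abs_nonneg _)
  · -- far representatives: `dist = 1 − |x − y|` and both points are within `dist` of the seam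
    push Not at hxy
    have hxy1 : |x - y| ≤ 1 := by
      calc |x - y| ≤ |x| + |y| := abs_sub _ _
        _ ≤ 1 / 2 + 1 / 2 := add_le_add hx hy
        _ = 1 := by norm_num
    -- the representative of `x − y` in `[−½, ½]`
    have hd : dist ((x : ℝ) : AddCircle (1 : ℝ)) ((y : ℝ) : AddCircle (1 : ℝ)) = 1 - |x - y| := by
      rw [hdist]
      rcases le_or_gt 0 (x - y) with hpos | hneg
      · rw [abs_of_nonneg hpos] at hxy hxy1 ⊢
        have e : ((x - y : ℝ) : AddCircle (1 : ℝ)) = ((x - y - 1 : ℝ) : AddCircle (1 : ℝ)) := by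
          have e' := AddCircle.coe_add_period (1 : ℝ) (x - y - 1)
          rw [show x - y - 1 + 1 = x - y by ring] at e'
          exact e'
        rw [e, norm_coe_eq_abs_of_le (by rw [abs_le]; constructor <;> linarith),
          abs_of_nonpos (by linarith)]
        ring
      · rw [abs_of_neg hneg] at hxy hxy1 ⊢
        have e : ((x - y : ℝ) : AddCircle (1 : ℝ)) = ((x - y + 1 : ℝ) : AddCircle (1 : ℝ)) :=
          (AddCircle.coe_add_period (1 : ℝ) (x - y)).symm
        rw [e, norm_coe_eq_abs_of_le (by rw [abs_le]; constructor <;> linarith),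
          abs_of_nonneg (by linarith)]
        ring
    set δ := dist ((x : ℝ) : AddCircle (1 : ℝ)) ((y : ℝ) : AddCircle (1 : ℝ)) with hδ
    have hxδ : 1 / 2 - δ ≤ |x| := by
      have : |x - y| ≤ |x| + |y| := abs_sub _ _
      linarith
    have hyδ : 1 / 2 - δ ≤ |y| := by
      have : |x - y| ≤ |x| + |y| := abs_sub _ _
      linarith
    by_cases hsmall : δ < 1 / 2 - r₂
    · -- both vanish
      have ha0 : Ψ (x : AddCircle (1 : ℝ)) = 0 := hvan _ (by rw [← hxa]; linarith)
      have hb0 : Ψ (y : AddCircle (1 : ℝ)) = 0 := hvan _ (by rw [← hyb]; linarith)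
      rw [ha0, hb0, sub_zero, norm_zero]
      exact mul_nonneg (by linarith) hd0
    · push Not at hsmall
      have h2 : ‖Ψ (x : AddCircle (1 : ℝ)) - Ψ (y : AddCircle (1 : ℝ))‖ ≤ 2 :=
        (norm_sub_le _ _).trans (by linarith [hb (x : AddCircle (1 : ℝ)), hb (y : AddCircle (1 : ℝ))])
      have h3 : (2 : ℝ) ≤ 2 / (1 / 2 - r₂) * δ := by
        rw [div_mul_eq_mul_div, le_div_iff₀ hgap]
        nlinarith
      calc ‖Ψ (x : AddCircle (1 : ℝ)) - Ψ (y : AddCircle (1 : ℝ))‖ ≤ 2 := h2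
        _ ≤ 2 / (1 / 2 - r₂) * δ := h3
        _ ≤ (L + 2 / (1 / 2 - r₂)) * δ := mul_le_mul_of_nonneg_right (by linarith) hd0

end Summit.Parity.GeneralizedHardyLittlewood.GreenTaoLevelTwoGITwoCyclicInverse
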